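import Mathlib
import Summits.ValiantsHypothesis.ValiantsHypothesis.Theorems.GirthSidonMomentCurveElusiveNonResonantCover

/-!
# Small sumset cover for product-depth (first-order resonant) 2×2 cancellations
(supports `stub_swallowedInSmallSumset`, crux `MomentCurveElusive`, item stmt-ValiantsHypothesis-6534,
route GirthSidon, line `registered`)

Continuation of `GirthSidonMomentCurveElusiveNonResonantCover`.  For a 2×2 cancellation at a balanced
weight the depth `γ = ord(u_a u_b − u_c u_d)` obeys the DEPTH TRICHOTOMY coming from the two identities
  `u_a u_b − u_c u_d = u_b (u_a − u_c) + u_c (u_b − u_d)`                       (cross form),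
  `u_a u_b − u_c u_d = (u_a − u_c)(u_b − u_c) + u_c (u_a + u_b − u_c − u_d)`     (product + linear form):
with the `t`-adic ultrametric `δ(x,z) = ord(u_x − u_z)`,
 (o) NON-RESONANT: `γ` is a cross distance `δ(α,β)`, `α ∈ {a,b}`, `β ∈ {c,d}` — covered by
     `exists_small_cover_of_crossDepth` (p173839), `|U| ≤ n(log₂ n + 1)`;
 (i) PRODUCT DEPTH: resonant (`δ(a,c) = δ(b,d) = g₁`, leading differences cancel) and the linear term is
     deeper than the product: then `γ = g₁ + g₂` with `g₂ = δ(a,d) = δ(b,c)` (the product form pivoted at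
     `c` and at `d`; in characteristic ≠ 2 the two cross distances at the second level agree);
 (ii) LINEAR DEPTH: `γ = ord(u_a + u_b − u_c − u_d)` strictly below the product depth;
 (iii) a tie between (i) and (ii) with further cancellation.
This file settles (i): `exists_small_cover_of_prodDepth` — if every target has
`D_i = o_{a_i} + o_{b_i} + g₁ + g₂` over a balanced weight with cross witnesses `δ(a,c) = δ(b,d) = g₁` and
`δ(a,d) = δ(b,c) = g₂`, then `D ⊆ U + U` with `|U| ≤ n (log₂ n + 1)²`
(`U = {o_x + g + g' : g, g' light for x or zero}`).  The attribution is a finite case analysis on the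
eight lightness bits of `g₁, g₂` at `a, b, c, d` (`light_or_light` on the four witnessing couples, plus —
according as `g₁ < g₂`, `g₁ = g₂`, `g₁ > g₂` — on the couple `(a,b)` or `(c,d)`, whose distance is forced
by the isosceles property `order_sub_eq_of_lt`).  So within 2×2-initiated targets the residual of the
cover statement is exactly the LINEAR-DEPTH class (ii)–(iii): depths equal to the order of the ±1 linear
combination `u_a + u_b − u_c − u_d`, i.e. levels of the ECHELON flag of `span(u_1, …, u_n)`.
-/

-- (Sub = Summit), so the duplicated namespace component is intended.
set_option linter.dupNamespace false

namespace Summit.ValiantsHypothesis.ValiantsHypothesis.Theorems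

open PowerSeries Finset

section ProdDepth

variable {R : Type*} [CommRing R]

/-- **The two forms of a 2×2 cancellation.** `u_a u_b − u_c u_d = u_b(u_a − u_c) + u_c(u_b − u_d)`
and `= (u_a − u_c)(u_b − u_c) + u_c(u_a + u_b − u_c − u_d)`. [folklore] -/
theorem gadget_eq_cross_and_prod (ua ub uc ud : R⟦X⟧) :
    ua * ub - uc * ud = ub * (ua - uc) + uc * (ub - ud) ∧
      ua * ub - uc * ud = (ua - uc) * (ub - uc) + uc * (ua + ub - uc - ud) := by
  constructor <;> ring

/-- **Depth lower bounds.** `ord(u_a u_b − u_c u_d) ≥ min(δ(a,c), δ(b,d))` and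
`≥ min(δ(a,c) + δ(b,c), ord(u_a + u_b − u_c − u_d))`. [folklore] -/
theorem order_gadget_ge (ua ub uc ud : R⟦X⟧) :
    min ((ua - uc).order) ((ub - ud).order) ≤ (ua * ub - uc * ud).order ∧
      min ((ua - uc).order + (ub - uc).order) ((ua + ub - uc - ud).order) ≤
        (ua * ub - uc * ud).order := by
  obtain ⟨h1, h2⟩ := gadget_eq_cross_and_prod ua ub uc ud
  constructor
  · rw [h1]
    refine le_trans ?_ (min_order_le_order_add _ _)
    apply min_le_min
    · exact le_trans (by simp) (le_order_mul ub (ua - uc))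
    · exact le_trans (by simp) (le_order_mul uc (ub - ud))
  · rw [h2]
    refine le_trans ?_ (min_order_le_order_add _ _)
    apply min_le_min
    · exact le_order_mul _ _
    · exact le_trans (by simp) (le_order_mul uc _)

/-- **Isosceles property of the `t`-adic distance.** If `ord(p − q) = g` and `ord(q − r) > g` then
`ord(p − r) = g`. [folklore] -/
theorem order_sub_eq_of_lt (p q r : R⟦X⟧) (g : ℕ) (hpq : (p - q).order = g)
    (hqr : (g : ℕ∞) < (q - r).order) : (p - r).order = g := by
  have h : p - r = (p - q) + (q - r) := by ring
  have hne : (p - q).order ≠ (q - r).order := by rw [hpq]; exact ne_of_lt hqr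
  rw [h, order_add_of_order_ne _ _ hne, hpq]
  exact min_eq_left (le_of_lt hqr)

/-- Propositional core of the attribution (unequal depths): the lightness bits of the four
witnessing couples, the failure of both candidate pairs, and the two extra couples at the smaller depth
are contradictory. [folklore] -/
theorem prodDepth_core_lt {la1 lb1 lc1 ld1 la2 lb2 lc2 ld2 : Prop}
    (hA : la1 ∨ lc1) (hB : lb1 ∨ ld1) (hC : la2 ∨ ld2) (hE : lb2 ∨ lc2)
    (hab : ¬((la1 ∨ lb1) ∧ (la2 ∨ lb2))) (hcd : ¬((lc1 ∨ ld1) ∧ (lc2 ∨ ld2)))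
    (hY1 : la1 ∨ lb1) (hY2 : lc1 ∨ ld1) : False := by
  tauto

/-- Propositional core of the attribution (equal depths). [folklore] -/
theorem prodDepth_core_eq {la lb lc ld : Prop}
    (hA : la ∨ lc) (hB : lb ∨ ld)
    (hab : ¬((la ∨ lb) ∧ (la ∨ lb))) (hcd : ¬((lc ∨ ld) ∧ (lc ∨ ld))) : False := by
  tauto

/-- Propositional core of the attribution (unequal depths, mirrored). [folklore] -/
theorem prodDepth_core_gt {la1 lb1 lc1 ld1 la2 lb2 lc2 ld2 : Prop}
    (hA : la1 ∨ lc1) (hB : lb1 ∨ ld1) (hC : la2 ∨ ld2) (hE : lb2 ∨ lc2)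
    (hab : ¬((la1 ∨ lb1) ∧ (la2 ∨ lb2))) (hcd : ¬((lc1 ∨ ld1) ∧ (lc2 ∨ ld2)))
    (hX2 : la2 ∨ lb2) (hX1 : lc2 ∨ ld2) : False := by
  tauto

/-- **Small sumset cover for product-depth 2×2 cancellations.**  Let `u_1, …, u_n` be arbitrary power
series, `o : Fin n → ℕ` weights, and let each of `m` targets have exponent
`D_i = o_{a_i} + o_{b_i} + g₁ + g₂` over a balanced weight `o_{a_i} + o_{b_i} = o_{c_i} + o_{d_i}`, with
cross witnesses `ord(u_a − u_c) = ord(u_b − u_d) = g₁` and `ord(u_a − u_d) = ord(u_b − u_c) = g₂`.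
Then `D ⊆ U + U` for some `U ⊂ ℕ` with `|U| ≤ n (log₂ n + 1)²`.  (Conclusion of
`stub_swallowedInSmallSumset` for first-order resonant 2×2-initiated targets whose linear term is deeper
than the product; together with `exists_small_cover_of_crossDepth` this leaves only linear-depth targets.)
[folklore] -/
theorem exists_small_cover_of_prodDepth {n m : ℕ} (u : Fin n → R⟦X⟧) (o : Fin n → ℕ)
    (a b c d : Fin m → Fin n) (D g₁ g₂ : Fin m → ℕ)
    (hD : ∀ i, D i = o (a i) + o (b i) + g₁ i + g₂ i)
    (hw : ∀ i, o (a i) + o (b i) = o (c i) + o (d i))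
    (hac : ∀ i, (u (a i) - u (c i)).order = g₁ i)
    (hbd : ∀ i, (u (b i) - u (d i)).order = g₁ i)
    (had : ∀ i, (u (a i) - u (d i)).order = g₂ i)
    (hbc : ∀ i, (u (b i) - u (c i)).order = g₂ i) :
    ∃ U : Finset ℕ, U.card ≤ n * (Nat.log 2 n + 1) ^ 2 ∧ ∀ i, ∃ p ∈ U, ∃ q ∈ U, D i = p + q := by
  classical
  -- a bound on the depths
  set G : ℕ := (univ.image g₁ ∪ univ.image g₂).sup id + 1 with hG
  have hg₁G : ∀ i, g₁ i < G := by
    intro i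
    have : g₁ i ≤ (univ.image g₁ ∪ univ.image g₂).sup id :=
      le_sup (f := id) (mem_union_left _ (mem_image_of_mem g₁ (mem_univ i)))
    omega
  have hg₂G : ∀ i, g₂ i < G := by
    intro i
    have : g₂ i ≤ (univ.image g₁ ∪ univ.image g₂).sup id :=
      le_sup (f := id) (mem_union_right _ (mem_image_of_mem g₂ (mem_univ i)))
    omega
  -- light radii of a source, with `0` adjoined
  set L : Fin n → Finset ℕ := fun x => insert 0 ((range G).filter fun g =>
    2 * (univ.filter fun y => ((g + 1 : ℕ) : ℕ∞) ≤ (u x - u y).order).card ≤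
      (univ.filter fun y => (g : ℕ∞) ≤ (u x - u y).order).card) with hL
  have hLcard : ∀ x, (L x).card ≤ Nat.log 2 n + 1 := by
    intro x
    rw [hL]
    refine le_trans (card_insert_le _ _) ?_
    simpa using Nat.le_log_of_pow_le (by norm_num) (two_pow_card_light_le u x G)
  have hL0 : ∀ x, 0 ∈ L x := fun x => by rw [hL]; exact mem_insert_self _ _
  have hLlight : ∀ x g, g < G →
      2 * (univ.filter fun y => ((g + 1 : ℕ) : ℕ∞) ≤ (u x - u y).order).card ≤
        (univ.filter fun y => (g : ℕ∞) ≤ (u x - u y).order).card → g ∈ L x := by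
    intro x g hg hl
    rw [hL]
    exact mem_insert_of_mem (mem_filter.2 ⟨mem_range.2 hg, hl⟩)
  -- the cover
  set U : Finset ℕ := univ.biUnion fun x => ((L x) ×ˢ (L x)).image fun p => o x + p.1 + p.2 with hU
  have hmemU : ∀ x g g', g ∈ L x → g' ∈ L x → o x + g + g' ∈ U := fun x g g' hg hg' =>
    mem_biUnion.2 ⟨x, mem_univ x, mem_image.2 ⟨(g, g'), mem_product.2 ⟨hg, hg'⟩, rfl⟩⟩
  refine ⟨U, ?_, ?_⟩
  · -- size
    calc U.card ≤ ∑ x : Fin n, (((L x) ×ˢ (L x)).image fun p => o x + p.1 + p.2).card :=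
          card_biUnion_le
      _ ≤ ∑ _x : Fin n, (Nat.log 2 n + 1) ^ 2 := by
          gcongr with x
          refine le_trans card_image_le ?_
          rw [card_product, sq]
          exact Nat.mul_le_mul (hLcard x) (hLcard x)
      _ = n * (Nat.log 2 n + 1) ^ 2 := by
          rw [sum_const, card_univ, Fintype.card_fin, smul_eq_mul]
  · -- cover
    intro i
    -- attribution inside a pair `{x, y}` at the right weight
    have attrib : ∀ x y : Fin n, D i = o x + o y + g₁ i + g₂ i →
        (g₁ i ∈ L x ∨ g₁ i ∈ L y) → (g₂ i ∈ L x ∨ g₂ i ∈ L y) →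
        ∃ p ∈ U, ∃ q ∈ U, D i = p + q := by
      intro x y hxy h1 h2
      rcases h1 with h1 | h1 <;> rcases h2 with h2 | h2
      · exact ⟨o x + g₁ i + g₂ i, hmemU _ _ _ h1 h2, o y + 0 + 0, hmemU _ _ _ (hL0 y) (hL0 y),
          by rw [hxy]; ring⟩
      · exact ⟨o x + g₁ i + 0, hmemU _ _ _ h1 (hL0 x), o y + g₂ i + 0, hmemU _ _ _ h2 (hL0 y),
          by rw [hxy]; ring⟩
      · exact ⟨o x + g₂ i + 0, hmemU _ _ _ h2 (hL0 x), o y + g₁ i + 0, hmemU _ _ _ h1 (hL0 y),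
          by rw [hxy]; ring⟩
      · exact ⟨o x + 0 + 0, hmemU _ _ _ (hL0 x) (hL0 x), o y + g₁ i + g₂ i, hmemU _ _ _ h1 h2,
          by rw [hxy]; ring⟩
    -- the eight lightness bits from the four witnessing couples
    have hA := light_or_light u (a i) (c i) (g₁ i) (hac i)
    have hB := light_or_light u (b i) (d i) (g₁ i) (hbd i)
    have hC := light_or_light u (a i) (d i) (g₂ i) (had i)
    have hE := light_or_light u (b i) (c i) (g₂ i) (hbc i)
    -- the two candidate pairs
    by_cases hab : ((g₁ i ∈ L (a i) ∨ g₁ i ∈ L (b i)) ∧ (g₂ i ∈ L (a i) ∨ g₂ i ∈ L (b i)))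
    · exact attrib (a i) (b i) (hD i) hab.1 hab.2
    by_cases hcd : ((g₁ i ∈ L (c i) ∨ g₁ i ∈ L (d i)) ∧ (g₂ i ∈ L (c i) ∨ g₂ i ∈ L (d i)))
    · exact attrib (c i) (d i) (by rw [hD i, hw i]) hcd.1 hcd.2
    exfalso
    -- lightness ⇒ membership
    have m1 : ∀ x, 2 * (univ.filter fun y => ((g₁ i + 1 : ℕ) : ℕ∞) ≤ (u x - u y).order).card ≤
        (univ.filter fun y => (g₁ i : ℕ∞) ≤ (u x - u y).order).card → g₁ i ∈ L x :=
      fun x hl => hLlight x (g₁ i) (hg₁G i) hl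
    have m2 : ∀ x, 2 * (univ.filter fun y => ((g₂ i + 1 : ℕ) : ℕ∞) ≤ (u x - u y).order).card ≤
        (univ.filter fun y => (g₂ i : ℕ∞) ≤ (u x - u y).order).card → g₂ i ∈ L x :=
      fun x hl => hLlight x (g₂ i) (hg₂G i) hl
    have hA' : g₁ i ∈ L (a i) ∨ g₁ i ∈ L (c i) := hA.imp (m1 _) (m1 _)
    have hB' : g₁ i ∈ L (b i) ∨ g₁ i ∈ L (d i) := hB.imp (m1 _) (m1 _)
    have hC' : g₂ i ∈ L (a i) ∨ g₂ i ∈ L (d i) := hC.imp (m2 _) (m2 _)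
    have hE' : g₂ i ∈ L (b i) ∨ g₂ i ∈ L (c i) := hE.imp (m2 _) (m2 _)
    rcases lt_trichotomy (g₁ i) (g₂ i) with hlt | heq | hgt
    · -- g₁ < g₂ : the couples (a,b) and (c,d) are at distance g₁
      have hab₁ : (u (a i) - u (b i)).order = g₁ i := by
        apply order_sub_eq_of_lt (u (a i)) (u (c i)) (u (b i)) (g₁ i) (hac i)
        rw [order_sub_comm, hbc i]; exact_mod_cast hlt
      have hcd₁ : (u (c i) - u (d i)).order = g₁ i := by
        apply order_sub_eq_of_lt (u (c i)) (u (a i)) (u (d i)) (g₁ i)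
          (by rw [order_sub_comm, hac i])
        rw [had i]; exact_mod_cast hlt
      have hY1 : g₁ i ∈ L (a i) ∨ g₁ i ∈ L (b i) :=
        (light_or_light u (a i) (b i) (g₁ i) hab₁).imp (m1 _) (m1 _)
      have hY2 : g₁ i ∈ L (c i) ∨ g₁ i ∈ L (d i) :=
        (light_or_light u (c i) (d i) (g₁ i) hcd₁).imp (m1 _) (m1 _)
      exact prodDepth_core_lt hA' hB' hC' hE' hab hcd hY1 hY2
    · -- g₁ = g₂
      rw [← heq] at hab hcd
      exact prodDepth_core_eq hA' hB' hab hcd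
    · -- g₂ < g₁ : the couples (a,b) and (c,d) are at distance g₂
      have hab₂ : (u (a i) - u (b i)).order = g₂ i := by
        apply order_sub_eq_of_lt (u (a i)) (u (d i)) (u (b i)) (g₂ i) (had i)
        rw [order_sub_comm, hbd i]; exact_mod_cast hgt
      have hcd₂ : (u (c i) - u (d i)).order = g₂ i := by
        apply order_sub_eq_of_lt (u (c i)) (u (b i)) (u (d i)) (g₂ i)
          (by rw [order_sub_comm, hbc i])
        rw [hbd i]; exact_mod_cast hgt
      have hX1 : g₂ i ∈ L (c i) ∨ g₂ i ∈ L (d i) :=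
        (light_or_light u (c i) (d i) (g₂ i) hcd₂).imp (m2 _) (m2 _)
      have hX2 : g₂ i ∈ L (a i) ∨ g₂ i ∈ L (b i) :=
        (light_or_light u (a i) (b i) (g₂ i) hab₂).imp (m2 _) (m2 _)
      exact prodDepth_core_gt hA' hB' hC' hE' hab hcd hX2 hX1

end ProdDepth

/-- **Registered helper stub `helper_prodDepthCover`** (crux stmt-ValiantsHypothesis-6534, line
`registered`): `exists_small_cover_of_prodDepth` over `ℂ`, spelled out with all binders — product-depth
(first-order resonant) 2×2-initiated born exponents lie in `U + U` with `|U| ≤ n (log₂ n + 1)²`.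
[folklore] -/
theorem helper_prodDepthCover : ∀ (n m : ℕ) (u : Fin n → PowerSeries ℂ) (o : Fin n → ℕ) (a b c d : Fin m → Fin n) (D g₁ g₂ : Fin m → ℕ), (∀ i, D i = o (a i) + o (b i) + g₁ i + g₂ i) → (∀ i, o (a i) + o (b i) = o (c i) + o (d i)) → (∀ i, (u (a i) - u (c i)).order = (g₁ i : ℕ∞)) → (∀ i, (u (b i) - u (d i)).order = (g₁ i : ℕ∞)) → (∀ i, (u (a i) - u (d i)).order = (g₂ i : ℕ∞)) → (∀ i, (u (b i) - u (c i)).order = (g₂ i : ℕ∞)) → ∃ U : Finset ℕ, U.card ≤ n * (Nat.log 2 n + 1) ^ 2 ∧ ∀ i, ∃ p ∈ U, ∃ q ∈ U, D i = p + q :=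
  fun _ _ u o a b c d D g₁ g₂ hD hw hac hbd had hbc =>
    exists_small_cover_of_prodDepth u o a b c d D g₁ g₂ hD hw hac hbd had hbc

end Summit.ValiantsHypothesis.ValiantsHypothesis.Theorems
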